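import Summits.ResolutionOfSingularities.ResolutionOfSingularities.Theorems.HomologicalConductorNoZenoChiCountAcyclic
import Summits.ResolutionOfSingularities.ResolutionOfSingularities.Theorems.HomologicalConductorNoZenoExcDegreeOnePoint
import Summits.ResolutionOfSingularities.ResolutionOfSingularities.Theorems.HomologicalConductorNoZenoH0LeResidueDegree
import Summits.ResolutionOfSingularities.ResolutionOfSingularities.Theorems.HomologicalConductorNoZenoIncidenceGraph
import Literature.AlgebraicGeometry.Resolution.Lipman1969IntersectionTheory
import Literature.AlgebraicGeometry.Resolution.Lipman1969RationalContractionRegime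
import Literature.AlgebraicGeometry.Resolution.ExceptionalCurvePoints
import Literature.AlgebraicGeometry.Resolution.PrimeDivisorIdeals
import Literature.AlgebraicGeometry.Motives.CartierDivisorOfIdealSheaf
import HarnessLib

/-!
# Crux `NoZenoR` / `NoZeno` (stmt-ResolutionOfSingularities-19943 / -16483) — slot 5 (B1) UP-6: THE INCIDENCE GRAPH OF A
# RESOLUTION OF A RATIONAL SURFACE SINGULARITY IS ACYCLIC (Lipman's `p_a`-count, over the tree's `h0` numerics)

Route `ResolutionOfSingularities/HomologicalConductor`, W4.4 chain, slot 5 `stub_L1wCoreF3` (B1) upstairs brick UP-6 (res-L0-w44-lead-1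
OFFER (o-UP6) / B1-CENSUS-g8 §1; res-L0-w44-plan-1 DESK WORD 5 (b), 7 (a)(b), lead CONCUR 19:19:36Z; hand res-L0-w44-stub-3 g14).
LEVEL (2) of the two-level architecture: the fact-free combinatorial core `ChiCount.isAcyclic_of_chiCount`
(`…NoZenoChiCountAcyclic`) instantiated on a resolution `π : X → Spec S` of a two-dimensional normal Noetherian local domain `S`
with a RATIONAL singularity, with

* `χ s := h⁰(𝒪_X / ∏_{η ∈ s} 𝓘_η)` (`h0 π (s.map primeDivisorIdeal).prod`, Lipman's `h⁰ = χ` in the rational regime) and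
  `r η := h⁰(E_η) = h0 π 𝓘_η`;
* (B) = **F-97b** `Lipman1969_13_1_b_rat` (bi-additivity of the d)-pairing `(A·B)_χ := χ A + χ B − χ(A+B)`), a BINDER `(h131b)`;
* (N) = the d)-pairing of two DISTINCT exceptional curves is `([E_w]·E_v) ≥ 0`: **F-97d** `Lipman1969_13_1_d_rat` (binder `(h131d)`)
  + the tree's `excCurveDegree_nonneg_of_isEffective` (`[E_w]` avoids `η_v`: distinct height-one points do not specialise to each
  other);
* (A) = on an EDGE (the closures of `E_v`, `E_w` meet at some `x`), `([E_w]·E_v) ≥ h⁰(E_v)`: F-97d + the ONE-POINT BOUND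
  «`h⁰(E_v) ≤ [κ(x):κ] ≤ ([E_w]·E_v)`» — the in-tree replacement of Lipman (13.1) a)+c) (DESK WORDs 7 (b)/8/9): res-L1-type-o5's
  (o-H1) `h0_primeDivisorIdeal_toNat_le_residueDegree_ofPointPt` (`…NoZenoH0LeResidueDegree`, p562340) composed with res-D-pv-045's
  (o-H2) `residueDegree_ofPointPt_le_excCurveDegree_of_ne` (`…NoZenoExcDegreeOnePoint`, p563011); in the universe-polymorphic statement
  `isAcyclic_of_adj_iff_of_h0Bound` it is the explicit hypothesis `hH`, discharged at universe `0` (o5's files) in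
  `h0_toNat_le_excCurveDegree_of_specializes`;
* (P) = `1 ≤ h⁰(𝒪_X/∏ 𝓘_η)` for a non-empty product: FINITE (`h0_ne_top_of_base_eq_closedPoint`, the support `⋃ cl{η}` lies over
  the closed point) and NON-ZERO (`V(∏ 𝓘_η)` is non-empty, so its ring of sections is non-trivial) — PROVED here
  (`one_le_h0_prod`).

Main theorems: **`isAcyclic_of_adj_iff_of_h0Bound`** (universe-polymorphic, one-point bound as hypothesis `hH`): for ANY
`G : SimpleGraph X` whose adjacency is «distinct exceptional curves with a common specialisation» (`hG`), `G.IsAcyclic`; and at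
universe `0` **`incidenceGraph_isAcyclic : (incidenceGraph π).IsAcyclic`** for res-L1-type-o5's `incidenceGraph π`
(`…NoZenoIncidenceGraph`, p561593; `adj_iff_exists_mem`) with `hH` discharged.  The acyclicity is stated WITHOUT a split-weight
hypothesis (Lipman's generality: `r_v = h⁰(E_v)` is the constants degree, not the split weight).  Facts bound: `(h131b) (h131d)` ONLY
(∈ `Sig.FactsW3` of v33, dischargeable by the slot-5 closer; desk ruling DESK WORD 7 (b)).
OURS (cell res-hironaka): AI-produced and kernel-checked, weaker than expert review; nothing here is a statement of the manuscript
under review (Hironaka 2017); def-free, counted 0.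
-/

noncomputable section

-- single-problem summit: the doubled namespace component `ResolutionOfSingularities` is forced
set_option linter.dupNamespace false

open CategoryTheory AlgebraicGeometry TopologicalSpace IsLocalRing
open Literature.AlgebraicGeometry.Resolution
open Literature.AlgebraicGeometry.Motives
open Literature.AlgebraicGeometry.Morphisms

universe u

namespace Summit.ResolutionOfSingularities.ResolutionOfSingularities.Theorems.NoZeno.ExcCount

section Support

variable {X : Scheme.{u}}

/-- **Support of a product of prime-divisor ideals**: a point of `V(∏_{η ∈ s} 𝓘_η)` is a specialisation of some `η ∈ s`
(`support_mul` + `mem_support_primeDivisorIdeal_iff`, by induction on the multiset). OURS. [folklore] -/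
theorem exists_specializes_of_mem_support_prod (s : Multiset X) {x : X}
    (hx : x ∈ ((s.map primeDivisorIdeal).prod).support) : ∃ η ∈ s, η ⤳ x := by
  induction s using Multiset.induction_on with
  | empty =>
    exfalso
    rw [Multiset.map_zero, Multiset.prod_zero, Scheme.IdealSheafData.one_eq_top,
      Scheme.IdealSheafData.support_top] at hx
    exact hx
  | cons a s ih =>
    rw [Multiset.map_cons, Multiset.prod_cons, Scheme.IdealSheafData.support_mul] at hx
    rcases hx with hxa | hxs
    · exact ⟨a, Multiset.mem_cons_self a s, (mem_support_primeDivisorIdeal_iff a x).mp hxa⟩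
    · obtain ⟨η, hη, hsp⟩ := ih hxs
      exact ⟨η, Multiset.mem_cons_of_mem hη, hsp⟩

/-- `η ∈ s` lies in the support of `∏_{η ∈ s} 𝓘_η`. OURS. [folklore] -/
theorem mem_support_prod_of_mem (s : Multiset X) {η : X} (hη : η ∈ s) :
    η ∈ ((s.map primeDivisorIdeal).prod).support := by
  induction s using Multiset.induction_on with
  | empty => exact absurd hη (Multiset.notMem_zero η)
  | cons a s ih =>
    rw [Multiset.map_cons, Multiset.prod_cons, Scheme.IdealSheafData.support_mul]
    rcases Multiset.mem_cons.mp hη with rfl | hηs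
    · exact Or.inl ((mem_support_primeDivisorIdeal_iff _ _).mpr specializes_rfl)
    · exact Or.inr (ih hηs)

end Support

section Positivity

variable {S : Type u} [CommRing S] [IsNoetherianRing S] [IsLocalRing S]
  {X : Scheme.{u}} (π : X ⟶ Spec (.of S)) [IsProper π]

/-- **(P) `1 ≤ h⁰(𝒪_X / ∏_{η ∈ s} 𝓘_η)` for a non-empty multiset `s` of exceptional-curve points**: the length is FINITE
(every point of `V(∏ 𝓘_η)` specialises from some `η ∈ s`, hence lies over the closed point — `h0_ne_top_of_base_eq_closedPoint`) and
NON-ZERO (`η ∈ s` is a point of `V(∏ 𝓘_η)`, so its ring of global sections maps to the non-trivial local ring at that point).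
OURS. [folklore] -/
theorem one_le_h0_prod (s : Multiset X) (hs : s ≠ 0) (hgood : ∀ η ∈ s, η ∈ excCurvePoints π) :
    (1 : ℤ) ≤ ((h0 π (s.map primeDivisorIdeal).prod).toNat : ℤ) := by
  set 𝓘 : X.IdealSheafData := (s.map primeDivisorIdeal).prod with h𝓘
  -- finiteness
  have hfin : h0 π 𝓘 ≠ ⊤ := by
    refine h0_ne_top_of_base_eq_closedPoint π 𝓘 fun x => ?_
    have hmem : 𝓘.subschemeι.base x ∈ (𝓘.support : Set X) :=
      (Set.ext_iff.mp (Scheme.IdealSheafData.range_subschemeι (I := 𝓘)) _).mp (Set.mem_range_self x)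
    obtain ⟨η, hη, hsp⟩ := exists_specializes_of_mem_support_prod s hmem
    change π.base (𝓘.subschemeι.base x) = closedPoint S
    exact base_eq_closedPoint_of_specializes π (hgood η hη).1 hsp
  -- non-vanishing: a point of `V(𝓘)`
  obtain ⟨η, hη⟩ := Multiset.exists_mem_of_ne_zero hs
  have hηsupp : η ∈ (𝓘.support : Set X) := mem_support_prod_of_mem s hη
  obtain ⟨z, hz⟩ : ∃ z : 𝓘.subscheme, 𝓘.subschemeι.base z = η :=
    (Set.ext_iff.mp (Scheme.IdealSheafData.range_subschemeι (I := 𝓘)) η).mpr hηsupp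
  haveI : Nontrivial (Sections (𝓘.subschemeι ≫ π) ⊤) := by
    show Nontrivial Γ(𝓘.subscheme, ⊤)
    exact (𝓘.subscheme.presheaf.germ ⊤ z trivial).hom.domain_nontrivial
  have hpos : 0 < h0 π 𝓘 := Module.length_pos
  -- `toNat`
  have hnat : (1 : ℕ) ≤ (h0 π 𝓘).toNat := by
    have h := (ENat.coe_toNat hfin).symm ▸ hpos
    rw [← ENat.coe_toNat hfin] at hpos
    exact_mod_cast hpos
  exact_mod_cast hnat

end Positivity

section Acyclic

variable {S : Type u} [CommRing S] [IsNoetherianRing S] [IsLocalRing S] [IsDomain S] [IsIntegrallyClosed S]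
  {X : Scheme.{u}} [IsIntegral X] [IsLocallyNoetherian X] (π : X ⟶ Spec (.of S))

omit [IsNoetherianRing S] [IsDomain S] [IsIntegrallyClosed S] [IsLocallyNoetherian X] in
/-- The effective Cartier divisor `[E_{η'}]` of a prime-divisor ideal AVOIDS every other exceptional-curve point `η ≠ η'`.
(res-D-pv-045's `not_specializes_of_mem_excCurvePoints_of_ne` + the lead's `avoids_ofIsEffectiveCartier_iff`). OURS. [folklore] -/
theorem avoids_of_ne {η η' : X} (hη : η ∈ excCurvePoints π) (hη' : η' ∈ excCurvePoints π) (hne : η ≠ η')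
    (hF : IsEffectiveCartier (primeDivisorIdeal η')) :
    (CartierDivisor.ofIsEffectiveCartier (primeDivisorIdeal η') hF).Avoids η := by
  rw [CartierDivisor.avoids_ofIsEffectiveCartier_iff, mem_support_primeDivisorIdeal_iff]
  exact not_specializes_of_mem_excCurvePoints_of_ne π hη hη' hne

/-- **UP-6, HYPOTHESIS FORM: A GRAPH OF MEETING EXCEPTIONAL CURVES OF A RATIONAL SURFACE SINGULARITY IS ACYCLIC** (Lipman's
`p_a`-count; desk ruling DESK WORD 7: F-97b/d as binders `(h131b) (h131d)`, the one-point bound as the hypothesis `hH` = the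
shape of (o-H1) ∘ (o-H2)).  For `π : X → Spec S` a resolution of a two-dimensional normal Noetherian local domain with a
rational singularity and ANY simple graph `G` on the points of `X` whose adjacency is «distinct points of `excCurvePoints π` with a
common specialisation» (`hG`; = `incidenceGraph π`): `G.IsAcyclic`.  Instance of `ChiCount.isAcyclic_of_chiCount` with
`χ s = h⁰(𝒪_X/∏_{η∈s} 𝓘_η)`, `r η = h⁰(E_η)`.  Universe-polymorphic; `hH` is discharged at universe `0` below. OURS. [folklore] -/
theorem isAcyclic_of_adj_iff_of_h0Bound (h2 : ringKrullDim S = 2) (hrat : HasRationalSingularity S) (hπ : IsResolution π)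
    (h131b : Lipman1969_13_1_b_rat.{u}) (h131d : Lipman1969_13_1_d_rat.{u})
    (hH : ∀ ⦃η η' x : X⦄, η ∈ excCurvePoints π → η' ∈ excCurvePoints π → η ≠ η' → η ⤳ x → η' ⤳ x →
      ∀ hF : IsEffectiveCartier (primeDivisorIdeal η'),
        ((h0 π (primeDivisorIdeal η)).toNat : ℤ) ≤
          excCurveDegree π (CartierDivisor.ofIsEffectiveCartier (primeDivisorIdeal η') hF) η)
    (G : SimpleGraph X)
    (hG : ∀ η η' : X, G.Adj η η' ↔
      η ≠ η' ∧ η ∈ excCurvePoints π ∧ η' ∈ excCurvePoints π ∧ ∃ z : X, η ⤳ z ∧ η' ⤳ z) :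
    G.IsAcyclic := by
  haveI : IsProper π := hπ.isProper
  have hreg : Scheme.IsRegular X := hπ.isRegular
  -- effective Cartier divisors of the exceptional curves
  have hF : ∀ {η : X}, η ∈ excCurvePoints π → IsEffectiveCartier (primeDivisorIdeal η) := fun hη =>
    isEffectiveCartier_primeDivisorIdeal_of_isRegular hreg (hπ.coheight_eq_one_of_mem_excCurvePoints h2 hη)
  -- the d)-pairing of two distinct curves is the intersection number `([E_w]·E_v)`
  have hpair : ∀ {v w : X} (hv : v ∈ excCurvePoints π) (hw : w ∈ excCurvePoints π),
      ((h0 π ((({v} : Multiset X) + {w}).map primeDivisorIdeal).prod).toNat : ℤ) =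
        ((h0 π (primeDivisorIdeal v)).toNat : ℤ) + ((h0 π (primeDivisorIdeal w)).toNat : ℤ) -
          excCurveDegree π (CartierDivisor.ofIsEffectiveCartier (primeDivisorIdeal w) (hF hw)) v := by
    intro v w hv hw
    have hd := h131d S h2 hrat X π hπ v hv w hw (hF hw)
    have hprod : ((({v} : Multiset X) + {w}).map primeDivisorIdeal).prod =
        primeDivisorIdeal w * primeDivisorIdeal v := by
      simp [mul_comm]
    rw [hprod]
    linarith
  refine ChiCount.isAcyclic_of_chiCount G (fun η => η ∈ excCurvePoints π)
    (fun s => ((h0 π (s.map primeDivisorIdeal).prod).toNat : ℤ))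
    (fun η => ((h0 π (primeDivisorIdeal η)).toNat : ℤ)) ?_ ?_ ?_ ?_ ?_ ?_
  · -- endpoints of edges are exceptional-curve points
    intro v w hvw
    obtain ⟨-, hv, hw, -⟩ := (hG v w).mp hvw
    exact ⟨hv, hw⟩
  · -- (B): F-97b with `s = {v}`, `t = {w}`
    intro v w u hv hw hu hgu
    have hb := h131b S h2 hrat X π hπ {v} {w} u (by simp) (by simp) hu (by simpa using hv) (by simpa using hw) hgu
    simp only [Multiset.map_singleton, Multiset.prod_singleton, mul_assoc] at hb
    simp only [Multiset.map_add, Multiset.prod_add, Multiset.map_singleton, Multiset.prod_singleton]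
    linarith
  · -- (N): distinct curves pair non-negatively
    intro v w hv hw hvw
    rw [hpair hv hw]
    simp only [Multiset.map_singleton, Multiset.prod_singleton]
    have h0le := excCurveDegree_nonneg_of_isEffective π hv
      (CartierDivisor.isEffective_ofIsEffectiveCartier (primeDivisorIdeal w) (hF hw)) (avoids_of_ne π hv hw hvw (hF hw))
    linarith
  · -- (A): on an edge the pairing is at least `h⁰(E_v)` (one-point bound `hH`)
    intro v w hvw
    obtain ⟨hne, hv, hw, z, hvz, hwz⟩ := (hG v w).mp hvw
    rw [hpair hv hw]
    simp only [Multiset.map_singleton, Multiset.prod_singleton]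
    have h := hH hv hw hne hvz hwz (hF hw)
    linarith
  · -- (1)
    intro v _
    simp
  · -- (P)
    intro s hs hgood
    exact one_le_h0_prod π s hs hgood

end Acyclic

section Unconditional

/-! ### Universe `0`: the one-point bound discharged by (o-H1) ∘ (o-H2), and the incidence graph of res-L1-type-o5 -/

variable {S : Type} [CommRing S] [IsNoetherianRing S] [IsLocalRing S] [IsDomain S] [IsIntegrallyClosed S]
  {X : Scheme.{0}} [IsIntegral X] [IsLocallyNoetherian X] (π : X ⟶ Spec (.of S))

omit [IsDomain S] [IsIntegrallyClosed S] in
/-- **The one-point bound `h⁰(E_η) ≤ ([E_{η'}]·E_η)` on an edge** (in-tree replacement of Lipman (13.1) a)+c), DESK WORD 7 (b)): for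
distinct exceptional-curve points `η ≠ η'` with a common specialisation `x`, `(h0 π 𝓘_η).toNat ≤ excCurveDegree π [E_{η'}] η` —
res-L1-type-o5's `h0_primeDivisorIdeal_toNat_le_residueDegree_ofPointPt` (`h⁰(E_η) ≤ [κ(x):κ(𝔪)]`: `Γ(E_η, 𝒪)` is a field over
`κ(𝔪)` embedding in `κ(x)`) followed by res-D-pv-045's `residueDegree_ofPointPt_le_excCurveDegree_of_ne` (p563011; `[κ(x):κ(𝔪)] ≤ ([E_{η'}]·E_η)`:
one summand of the point-sum defining `excCurveDegree`, the local equation of `[E_{η'}]` being a non-unit at `x`). OURS. [folklore] -/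
theorem h0_toNat_le_excCurveDegree_of_specializes [IsProper π] {η η' x : X} (hη : η ∈ excCurvePoints π)
    (hη' : η' ∈ excCurvePoints π) (hne : η ≠ η') (hx : η ⤳ x) (hx' : η' ⤳ x)
    (hF : IsEffectiveCartier (primeDivisorIdeal η')) :
    ((h0 π (primeDivisorIdeal η)).toNat : ℤ) ≤
      excCurveDegree π (CartierDivisor.ofIsEffectiveCartier (primeDivisorIdeal η') hF) η := by
  have hxη : x ≠ η := by
    rintro rfl
    exact not_specializes_of_mem_excCurvePoints_of_ne π hη hη' hne hx'
  have h1 := h0_primeDivisorIdeal_toNat_le_residueDegree_ofPointPt π hη hx hxη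
  have h2 := residueDegree_ofPointPt_le_excCurveDegree_of_ne π hη hη' hne hx hx' hF
  exact le_trans (by exact_mod_cast h1) h2

/-- **UP-6: THE INCIDENCE GRAPH OF A RESOLUTION OF A RATIONAL SURFACE SINGULARITY IS ACYCLIC** (slot 5 (B1) upstairs brick; Lipman
1969 §14: the exceptional configuration of a rational singularity is a tree — here the no-cycle half, for res-L1-type-o5's
`incidenceGraph π`).  For `π : X → Spec S` a resolution of a two-dimensional normal Noetherian local domain with a rational
singularity, modulo the two `Sig.FactsW3` facts F-97b/d as binders: `(incidenceGraph π).IsAcyclic`.  No split-weight hypothesis.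
(= `isAcyclic_of_adj_iff_of_h0Bound` + `h0_toNat_le_excCurveDegree_of_specializes` + `adj_iff_exists_mem`.) OURS. [folklore] -/
theorem incidenceGraph_isAcyclic (h2 : ringKrullDim S = 2) (hrat : HasRationalSingularity S) (hπ : IsResolution π)
    (h131b : Lipman1969_13_1_b_rat.{0}) (h131d : Lipman1969_13_1_d_rat.{0}) :
    (incidenceGraph π).IsAcyclic :=
  haveI : IsProper π := hπ.isProper
  isAcyclic_of_adj_iff_of_h0Bound π h2 hrat hπ h131b h131d
    (fun _ _ _ hη hη' hne hx hx' hF => h0_toNat_le_excCurveDegree_of_specializes π hη hη' hne hx hx' hF)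
    (incidenceGraph π) (fun _ _ => adj_iff_exists_mem)

end Unconditional

end Summit.ResolutionOfSingularities.ResolutionOfSingularities.Theorems.NoZeno.ExcCount

end
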